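import Mathlib
import HarnessLib
import Literature.Analysis.FluidPDE.AxisymmetricEuler
import Literature.Analysis.FluidPDE.AxisymmetricVorticityTransport
import Literature.Analysis.FluidPDE.CurlIsometryCovariance
import Literature.Analysis.FluidPDE.TaoEnstrophyLocalisation
import Literature.Analysis.FluidPDE.SelfSimilar
import Literature.Analysis.FluidPDE.LocalTypeI
import Literature.Analysis.FluidPDE.VectorCalculus
import Literature.Analysis.UnboundedOperators.HeatKernel
import Summits.NavierStokesRegularity.NavierStokesRegularity.Theorems.LocalSineTubeDoorProfileAlignedWindowRigidityAncient
import Summits.NavierStokesRegularity.NavierStokesRegularity.Theorems.PoloidalWindowDoorPoloidalWindowRigidityFlat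
import Summits.NavierStokesRegularity.NavierStokesRegularity.Theorems.PoloidalWindowDoorPoloidalWindowRigidityRotate
import Summits.NavierStokesRegularity.NavierStokesRegularity.Theorems.PoloidalWindowDoorPoloidalWindowRigidityAxisymmetric
import Summits.NavierStokesRegularity.NavierStokesRegularity.Theorems.PoloidalWindowDoorPoloidalWindowRigidityStrata
import Summits.NavierStokesRegularity.NavierStokesRegularity.Theorems.PoloidalWindowDoorPoloidalWindowRigidityAnyAxis
import Summits.NavierStokesRegularity.NavierStokesRegularity.Theorems.PoloidalWindowDoorPoloidalWindowRigidityVorticityAxisymmetric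

/-!
# Route `PoloidalWindowDoor`, crux `PoloidalWindowRigidity` (K2, stmt-NavierStokesRegularity-19708) — the stratum
# «axisymmetric VORTICITY» about an ARBITRARY axis (any direction, any centre)

Cell ns-regularity-ideate, seat ns-poloidal-K2-p3 (stub-worker; support theorem `--supports` the crux, `--as helper`;
companion of `…VorticityAxisymmetric` (vertical axis), pattern = nsreg-p6's `…AnyAxis`).

Let `v` be a profile of the route's Type-I class, poloidal along `e₃`.  Suppose that for some linear isometry `L`
of `ℝ³` and some centre `c` the VORTICITY of the profile in the frame of the axis `c + L(ℝe₃)`,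
`u(t, y) = L⁻¹ v(t, L y + c)`, is axisymmetric about the vertical axis on every slice (by the pseudovector law this
says: `curl v(s)` is axisymmetric, as a (pseudo)vector field, about the line `c + L(ℝe₃)`).  Then `v ≡ 0`:

* `u` is again a profile of the class (nsreg-p6 `class_translate`, `class_conj_linearIsometryEquiv`), poloidal along
  `e' = L⁻¹e₃` (tree `inner_curl_conj_linearIsometryEquiv_eq_zero_iff`);
* if `e' ∥ e₃`, `u` is poloidal along `e₃` with axisymmetric vorticity: this seat's
  `…VorticityAxisymmetric.eq_zero_of_curl_axisymmetric` (div–curl Liouville ⇒ `u(s) − u(s)(0)` axisymmetric;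
  vorticity equation ⇒ the horizontal drift is invisible; then stratum (A) or KNSS Thm 5.2);
* if `e' ∦ e₃`, the vorticity is an axisymmetric field orthogonal to the non-vertical `e'`, hence VERTICAL (nsreg-p6
  `cross_single_two_eq_zero_of_isAxisymmetric`) = unidirectional, and nsreg-p6's `eq_zero_of_aligned` ends — no
  dynamics needed in this case.

So the residue may assume «on every slice the vorticity is axisymmetric about NO axis whatsoever».

WHAT THIS IS NOT: not a claim about Navier–Stokes regularity and not the open residue — one more settled stratum of
a door route's Type-I Liouville problem (bears_on LADDER-NS N0, rung N0-LocalTubeDoorPoloidal).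
-/

noncomputable section

-- the summit and its single sub-problem share the name (CONVENTIONS §1), as in every Theorems file
set_option linter.dupNamespace false

namespace Summit.NavierStokesRegularity.NavierStokesRegularity.Theorems.PoloidalWindowDoorPoloidalWindowRigidityVorticityAxisymmetricAnyAxis

open MeasureTheory Set Function Filter Topology TopologicalSpace Metric InnerProductSpace
open scoped RealInnerProductSpace InnerProductSpace
open Literature.Analysis Literature.Analysis.FluidPDE
open Summit.NavierStokesRegularity.NavierStokesRegularity.Theorems.LocalSineTubeDoorProfileAlignedWindowRigidityAncient
open Summit.NavierStokesRegularity.NavierStokesRegularity.Theorems.PoloidalWindowDoorPoloidalWindowRigidityFlat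
open Summit.NavierStokesRegularity.NavierStokesRegularity.Theorems.PoloidalWindowDoorPoloidalWindowRigidityRotate
open Summit.NavierStokesRegularity.NavierStokesRegularity.Theorems.PoloidalWindowDoorPoloidalWindowRigidityAxisymmetric
open Summit.NavierStokesRegularity.NavierStokesRegularity.Theorems.PoloidalWindowDoorPoloidalWindowRigidityStrata
open Summit.NavierStokesRegularity.NavierStokesRegularity.Theorems.PoloidalWindowDoorPoloidalWindowRigidityAnyAxis
open Summit.NavierStokesRegularity.NavierStokesRegularity.Theorems.PoloidalWindowDoorPoloidalWindowRigidityVorticityAxisymmetric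

variable {C : ℝ} {v : ℝ → EuclideanSpace ℝ (Fin 3) → EuclideanSpace ℝ (Fin 3)}

/-- **Poloidal + VORTICITY axisymmetric about an ARBITRARY axis ⇒ trivial.**  Let `v` be a profile of the route's
Type-I class, poloidal along `e₃` on every slice.  If for some linear isometry `L` of `ℝ³` and some centre `c` the
vorticity of the profile in the frame of the axis, `curl (y ↦ L⁻¹ v(s, L y + c))`, is axisymmetric about the
`x₃`-axis for every `s < 0`, then `v ≡ 0` on the slab. -/
theorem eq_zero_of_curl_axisymmetric_anyAxis (hrate : HasTypeITimeDecay C v)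
    (hcont : ContinuousOn (uncurry v) (Iio (0 : ℝ) ×ˢ univ))
    (hmild : ∀ s t : ℝ, s < t → t < 0 → ∀ x,
      v t x = UnboundedOperators.heatExtension (v s) (t - s) x - oseenDuhamel 1 s v v t x)
    (hdiv : ∀ t < 0, VectorCalculus.IsDivFree (v t))
    (hpol : ∀ s < 0, ∀ y, ⟪curl (v s) y, EuclideanSpace.single 2 1⟫_ℝ = 0)
    (L : EuclideanSpace ℝ (Fin 3) ≃ₗᵢ[ℝ] EuclideanSpace ℝ (Fin 3)) (c : EuclideanSpace ℝ (Fin 3))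
    (haxi : ∀ s < 0, IsAxisymmetric (curl (fun y => L.symm (v s (L y + c))))) :
    ∀ t < 0, ∀ x, v t x = 0 := by
  -- ## the profile in the frame of the axis: `u(t, y) = L⁻¹ v(t, L y + c)`
  obtain ⟨hrate₁, hcont₁, hmild₁, hdiv₁⟩ := class_translate c hrate hcont hmild hdiv
  obtain ⟨hrate', hcont', hmild', hdiv'⟩ := class_conj_linearIsometryEquiv L.symm hrate₁ hcont₁ hmild₁ hdiv₁
  simp only [LinearIsometryEquiv.symm_symm] at hrate' hcont' hmild' hdiv'
  set u : ℝ → EuclideanSpace ℝ (Fin 3) → EuclideanSpace ℝ (Fin 3) := fun t y => L.symm (v t (L y + c)) with hu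
  have haxiu : ∀ s < 0, IsAxisymmetric (curl (u s)) := fun s hs => haxi s hs
  -- `u` is poloidal along `e' := L⁻¹ e₃`
  set e' : EuclideanSpace ℝ (Fin 3) := L.symm (EuclideanSpace.single 2 1) with he'
  have hpolu : ∀ σ < 0, ∀ y, ⟪curl (u σ) y, e'⟫_ℝ = 0 := by
    intro σ hσ y
    have h1 := (inner_curl_conj_linearIsometryEquiv_eq_zero_iff L.symm (fun z => v σ (z + c)) y e').2
    simp only [LinearIsometryEquiv.symm_symm] at h1
    refine h1 ?_
    have hc : curl (fun z => v σ (z + c)) (L y) = curl (v σ) (L y + c) := by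
      rw [curl_eq_curlCLM, curl_eq_curlCLM, fderiv_comp_add_right]
    rw [hc, he', LinearIsometryEquiv.apply_symm_apply]
    exact hpol σ hσ (L y + c)
  -- it suffices to show `u ≡ 0`
  suffices hzero : ∀ t < 0, ∀ y, u t y = 0 by
    intro t ht x
    have h := hzero t ht (L.symm (x - c))
    simp only [hu, LinearIsometryEquiv.apply_symm_apply, sub_add_cancel,
      LinearIsometryEquiv.map_eq_zero_iff] at h
    exact h
  by_cases hpar : cross e' (EuclideanSpace.single 2 1) = 0
  · -- ## Case A: `e' ∥ e₃` — `u` is poloidal along `e₃` with axisymmetric vorticity (vertical-axis stratum)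
    obtain ⟨he0, he1⟩ := (cross_single_two_eq_zero_iff e').1 hpar
    have he2 : e' 2 ≠ 0 := by
      intro he2
      have hz : e' = 0 := by
        ext i
        fin_cases i
        · exact he0
        · exact he1
        · exact he2
      have hne : (EuclideanSpace.single 2 1 : EuclideanSpace ℝ (Fin 3)) ≠ 0 := fun h0 => by
        simpa using congrArg (fun w : EuclideanSpace ℝ (Fin 3) => w 2) h0
      exact hne ((LinearIsometryEquiv.map_eq_zero_iff L.symm).1 (he'.symm.trans hz ▸ rfl))
    have hpolu3 : ∀ σ < 0, ∀ y, ⟪curl (u σ) y, EuclideanSpace.single 2 1⟫_ℝ = 0 := by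
      intro σ hσ y
      have h1 := hpolu σ hσ y
      have hexp : ⟪curl (u σ) y, e'⟫_ℝ = e' 2 * curl (u σ) y 2 := by
        simp only [PiLp.inner_apply, RCLike.inner_apply, conj_trivial, Fin.sum_univ_three, he0, he1]
        ring
      rw [hexp] at h1
      have h2 : curl (u σ) y 2 = 0 := (mul_eq_zero.1 h1).resolve_left he2
      simp [EuclideanSpace.inner_single_right, h2]
    exact eq_zero_of_curl_axisymmetric hrate' hcont' hmild' hdiv' hpolu3 haxiu
  · -- ## Case B: `e' ∦ e₃` — an axisymmetric vorticity orthogonal to `e'` is vertical, hence unidirectional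
    have he : e' 0 ≠ 0 ∨ e' 1 ≠ 0 := by
      by_contra hne
      push Not at hne
      exact hpar ((cross_single_two_eq_zero_iff e').2 hne)
    have hs : (-1 : ℝ) < 0 := by norm_num
    have hal : ∀ y, cross (curl (u (-1)) y) (EuclideanSpace.single 2 1) = 0 :=
      cross_single_two_eq_zero_of_isAxisymmetric (haxiu (-1) hs) he (hpolu (-1) hs)
    have hne : (EuclideanSpace.single 2 1 : EuclideanSpace ℝ (Fin 3)) ≠ 0 := fun h0 => by
      simpa using congrArg (fun w : EuclideanSpace ℝ (Fin 3) => w 2) h0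
    exact eq_zero_of_aligned hrate' hcont' hmild' hdiv' hne hs hal

/-- **Axisymmetric vorticity about an arbitrary axis ⇒ not backward-singular.** -/
theorem nonflatLiouville_of_curl_axisymmetric_anyAxis (hrate : HasTypeITimeDecay C v)
    (hcont : ContinuousOn (uncurry v) (Iio (0 : ℝ) ×ˢ univ))
    (hmild : ∀ s t : ℝ, s < t → t < 0 → ∀ x,
      v t x = UnboundedOperators.heatExtension (v s) (t - s) x - oseenDuhamel 1 s v v t x)
    (hdiv : ∀ t < 0, VectorCalculus.IsDivFree (v t))
    (hpol : ∀ s < 0, ∀ y, ⟪curl (v s) y, EuclideanSpace.single 2 1⟫_ℝ = 0)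
    (L : EuclideanSpace ℝ (Fin 3) ≃ₗᵢ[ℝ] EuclideanSpace ℝ (Fin 3)) (c : EuclideanSpace ℝ (Fin 3))
    (haxi : ∀ s < 0, IsAxisymmetric (curl (fun y => L.symm (v s (L y + c))))) :
    ¬ IsBackwardSingularPoint v 0 :=
  not_backwardSingular_of_zero (eq_zero_of_curl_axisymmetric_anyAxis hrate hcont hmild hdiv hpol L c haxi)

end Summit.NavierStokesRegularity.NavierStokesRegularity.Theorems.PoloidalWindowDoorPoloidalWindowRigidityVorticityAxisymmetricAnyAxis

end
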